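import Summits.QuantumFields.YangMills.Theorems.LangevinControlUVOSLegsAtWeakCouplingCStubRope
import HarnessLib

/-!
# `BalabanLadder.IR` (stmt-QuantumFields-19354), ideator line `cofinal-leaf` — support 2/4:
# the reflection-positivity rope with the gap hypothesis on a PRESCRIBED SET OF COUPLINGS

Support file for the crux item stmt-QuantumFields-19354 (`Summit.QuantumFields.YangMills.Theses.BalabanLadder.IR`),
ideator seat `ym-ir-idea-12` (lens «wuc», generation 2).  HONEST FRAMING: nothing here is asserted about Yang–Mills;
every binder is a hypothesis about LATTICE Yang–Mills; `YangMills` (Clay) is NOT proved by any of this.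

WHAT.  The tree's anchor `OSLegsAtWeakCouplingC.exists_anchor` (`…StubRopeAnchor.lean`) and rope
`DlrCollarTransfer.stub_rope` (`…StubRope.lean`, registered stub of crux `OSLegsAtWeakCouplingC`) re-run with ONE
change each: the H3 hypothesis `GapInUnits G r a` is replaced by its body RESTRICTED TO A SET OF COUPLINGS `Bset`
(extra binder `β ∈ Bset →`; no new definition), and correspondingly
* `exists_anchor_on`: the anchor bound holds at every `β ∈ Bset` with `β₂ ≤ β`;
* `stub_rope_onCouplings`: demands `(b₀, g)` and a rate `Δ > 0` such that every soft bundle meeting them WHOSE SCHEME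
  COUPLINGS LIE IN `Bset` (`∀ k, sch.β k ∈ Bset`) has a limit family with `RPPos` and `Decay Δ`.
The anchor is the only place the rope reads H3, and it reads it at `β = sch.β k` only (one `hanchor` call); the
proofs are byte-identical with the tree's except for that binder.  With `Bset = Set.univ` they are the tree theorems.

WHY.  Together with support 1/4 (`softLegs_joint_growth_onCouplings`: the soft bundle can be extracted with all its
couplings in any COFINAL `Bset`) this shows the summit bridge consumes the IR leg only on a cofinal set of couplings
(support 3/4, `yangMills_of_cofinalLegs`).
Refs: OsterwalderSeiler1978 §2; GlimmJaffe1987 §6.1, §19.7; the tree files above. [folklore]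
-/

set_option autoImplicit false

noncomputable section

open scoped SchwartzMap ComplexConjugate BigOperators
open MeasureTheory Filter Topology
open Literature.MathematicalPhysics.QuantumFieldTheory Literature.MathematicalPhysics.QuantumLattice
open Literature.MathematicalPhysics.AQFT
open Literature.Probability.LatticeModels (box Site box_mono mem_box)
open Summit.QuantumFields.YangMills.Cruxes.OSLegsFromFemtoAndGap.DlrCollarTransfer
open Summit.QuantumFields.YangMills.Theorems.OSLegsFromFemtoAndGap
open Summit.QuantumFields.YangMills.Theorems.FiniteSusceptibilityWeakCoupling.RPCauchySchwarz
  (wilsonMeasure_map_timeReflect)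

/-! ## §1 The anchor on a set of couplings -/

namespace Summit.QuantumFields.YangMills.Theorems.OSLegsAtWeakCouplingC

local notation "E4" => EuclideanSpace ℝ (Fin 4)

open Anchor

/-- **The H3 anchor of the rope, H3 given on a set of couplings `Bset` only** (`exists_anchor` verbatim with the
binder `β ∈ Bset →` added to hypothesis and conclusion). -/
theorem exists_anchor_on : ∀ {G : Type} [Group G] [TopologicalSpace G] [IsTopologicalGroup G] [CompactSpace G]
    [MeasurableSpace G] [BorelSpace G] (r : LatticeRep G) {a : ℝ → ℝ} (Bset : Set ℝ)
    (hgap : ∃ (c₁ β₂ : ℝ) (S₁ : ℝ → ℕ), 0 < c₁ ∧ ∀ A B : YMSpecies G, ∃ C : ℝ, ∀ β ∈ Bset, β₂ ≤ β →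
      ∀ S n : ℕ, S₁ β ≤ S → n ≤ S →
        |latticeConnectedCorr r.ρ β (2 * S + 1) A.F B.F n| ≤ C * Real.exp (-(c₁ * a β * n))), ∃ (c₁ β₂ : ℝ) (S₁g
    : ℝ → ℕ) (D : ℕ → ℕ → ℝ), 0 < c₁ ∧ (∀ n, Monotone (D n)) ∧ (∀ n R, 1 ≤ D n R) ∧ ∀ (β : ℝ), β ∈ Bset → β₂ ≤ β → ∀ (L : ℕ),
    S₁g β ≤ L → ∀ (M R : ℕ), R + M ≤ L → ∀ (s : ℝ) {n : ℕ} (F : 𝓢((Fin n → EuclideanSpace ℝ (Fin 4)), ℂ)), (∀ y :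
    Fin n → Site 4, F (fun l => s • siteToE (y l)) ≠ 0 → ∀ l, y l ∈ box 4 R ∧ 1 ≤ y l 0) → ‖osCorr (wilsonMeasure
    (d := 4) (L := 2 * L + 1) r.ρ β) GaugeConfig.timeReflect (⇑(torusTimeShift (2 * L + 1) M)) (fieldObs r L s F
    (fun pl => wilsonTorusMean r.ρ β L (fun U => plaquetteObs r.ρ 0 pl.1 pl.2 U))) (fieldObs r L s F (fun pl =>
    wilsonTorusMean r.ρ β L (fun U => plaquetteObs r.ρ 0 pl.1 pl.2 U)))‖ ≤ (∑ _q ∈ Fintype.piFinset (fun _ : Fin n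
    => Finset.univ.filter fun pl : Fin 4 × Fin 4 => pl.1 < pl.2), ∑ y ∈ Fintype.piFinset (fun _ : Fin n => box 4
    R), ‖F (fun l => s • siteToE (y l))‖) ^ 2 * D n R * Real.exp (-(c₁ * a β * M)) := by
  intro G _ _ _ _ _ _ r a Bset hgap
  obtain ⟨c₁, β₂, S₁, hc₁, hH3⟩ := hgap
  choose C hC using hH3
  choose spec hspec using fun (n : ℕ) (S : Finset (Fin n)) (q : Fin n → Fin 4 × Fin 4) (z : Fin n → Site 4) =>
    exists_species_prod_plane r S q z
  obtain ⟨Cp, hCp⟩ := exists_abs_plane_le (G := G) r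
  -- the index sets `(q, y, S)`, the pair constants, and `D`
  set I : (n : ℕ) → ℕ → Finset ((Fin n → Fin 4 × Fin 4) × (Fin n → Site 4) × Finset (Fin n)) := fun n R =>
    (Fintype.piFinset fun _ : Fin n => Finset.univ.filter fun pl : Fin 4 × Fin 4 => pl.1 < pl.2) ×ˢ
      ((Fintype.piFinset fun _ : Fin n => box 4 R) ×ˢ (Finset.univ : Finset (Fin n)).powerset) with hI
  set K : (n : ℕ) → ((Fin n → Fin 4 × Fin 4) × (Fin n → Site 4) × Finset (Fin n)) →
      ((Fin n → Fin 4 × Fin 4) × (Fin n → Site 4) × Finset (Fin n)) → ℝ := fun n i j =>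
    |C (spec n i.2.2 i.1 fun l => thetaSite (i.1 l) (i.2.1 l)) (spec n j.2.2 j.1 j.2.1)| with hK
  set D : ℕ → ℕ → ℝ := fun n R =>
    1 + 2 ^ n * 2 ^ n * max 1 Cp ^ n * max 1 Cp ^ n * ∑ i ∈ I n R, ∑ j ∈ I n R, K n i j with hD
  have hB1 : 1 ≤ max 1 Cp := le_max_left _ _
  have hKn : ∀ n i j, 0 ≤ K n i j := fun n i j => abs_nonneg _
  refine ⟨c₁, β₂, S₁, D, hc₁, fun n R R' hRR' => ?_, fun n R => ?_, ?_⟩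
  · -- monotonicity in `R`
    have hsub : I n R ⊆ I n R' := Finset.product_subset_product subset_rfl
      (Finset.product_subset_product (Fintype.piFinset_subset _ _ fun _ => box_mono 4 hRR') subset_rfl)
    have hsum : ∑ i ∈ I n R, ∑ j ∈ I n R, K n i j ≤ ∑ i ∈ I n R', ∑ j ∈ I n R', K n i j :=
      (Finset.sum_le_sum fun i _ => Finset.sum_le_sum_of_subset_of_nonneg hsub fun j _ _ => hKn n i j).trans
        (Finset.sum_le_sum_of_subset_of_nonneg hsub fun i _ _ => Finset.sum_nonneg fun j _ => hKn n i j)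
    show (1 : ℝ) + _ ≤ 1 + _
    have h0 : (0 : ℝ) ≤ 2 ^ n * 2 ^ n * max 1 Cp ^ n * max 1 Cp ^ n := by positivity
    linarith [mul_le_mul_of_nonneg_left hsum h0]
  · show (1 : ℝ) ≤ 1 + _
    exact le_add_of_nonneg_right (mul_nonneg (by positivity)
      (Finset.sum_nonneg fun i _ => Finset.sum_nonneg fun j _ => hKn n i j))
  -- the bound
  intro β hβmem hβ L hL M R hRM s n F hF
  have hRL : R ≤ L := by omega
  have hML : M ≤ L := by omega
  set μ := wilsonMeasure (d := 4) (L := 2 * L + 1) (G := G) r.ρ β with hμ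
  haveI : IsProbabilityMeasure μ := isProbabilityMeasure_wilsonMeasure (d := 4) (L := 2 * L + 1) r.ρ r.continuous β
  set m : Fin 4 × Fin 4 → ℝ := fun pl => wilsonTorusMean r.ρ β L (fun U => plaquetteObs r.ρ 0 pl.1 pl.2 U) with hm
  -- the centring constants are bounded by the plane sup
  have hmb : ∀ pl, |m pl| ≤ max 1 Cp := fun pl => by
    refine le_trans ?_ (le_max_right 1 Cp)
    have h := norm_integral_le_of_norm_le_const (μ := μ) (C := Cp)
      (f := fun U : GaugeConfig 4 (2 * L + 1) G => plaquetteObs r.ρ 0 pl.1 pl.2 (torusLift (2 * L + 1) U))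
      (Eventually.of_forall fun U => by
        rw [Real.norm_eq_abs, ← plane_eq_plaquetteObs r pl 0]
        exact hCp pl 0 _)
    rw [probReal_univ, mul_one, Real.norm_eq_abs] at h
    exact h
  -- coefficients and observables of the expansion of `X`
  set c : (Fin n → Fin 4 × Fin 4) × (Fin n → Site 4) × Finset (Fin n) → ℂ := fun i =>
    F (fun l => s • siteToE (i.2.1 l)) * ∏ l ∈ Finset.univ \ i.2.2, (-(m (i.1 l) : ℂ)) with hc
  set Xo : (Fin n → Fin 4 × Fin 4) × (Fin n → Site 4) × Finset (Fin n) → GaugeConfig 4 (2 * L + 1) G → ℂ :=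
    fun i U => ((∏ l ∈ i.2.2, plane G r (i.1 l) (i.2.1 l) (torusLift (2 * L + 1) U) : ℝ) : ℂ) with hXo
  have hX : fieldObs r L s F m = fun U => ∑ i ∈ I n R, c i * Xo i U :=
    funext fun U => fieldObs_eq_sum r hRL s F hF m U
  have hΘm : Measurable (GaugeConfig.timeReflect : GaugeConfig 4 (2 * L + 1) G → GaugeConfig 4 (2 * L + 1) G) :=
    WilsonRP.measurable_timeReflect
  have hτm : Measurable (⇑(torusTimeShift (G := G) (2 * L + 1) M)) := (torusTimeShift (2 * L + 1) M).measurable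
  have hXm : ∀ i, Measurable (Xo i) := fun i =>
    Complex.measurable_ofReal.comp (Finset.measurable_prod _ fun l _ => measurable_plane_lift r L (i.1 l) (i.2.1 l))
  have hXb : ∀ i, ∃ B, ∀ U, ‖Xo i U‖ ≤ B := fun i => ⟨∏ _l ∈ i.2.2, Cp, fun U => by
    show ‖((∏ l ∈ i.2.2, plane G r (i.1 l) (i.2.1 l) (torusLift (2 * L + 1) U) : ℝ) : ℂ)‖ ≤ _
    rw [Complex.norm_real, Real.norm_eq_abs, Finset.abs_prod]
    exact Finset.prod_le_prod (fun _ _ => abs_nonneg _) fun l _ => hCp _ _ _⟩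
  have hw : ∀ i ∈ I n R, ‖c i‖ ≤ ‖F (fun l => s • siteToE (i.2.1 l))‖ * max 1 Cp ^ n := fun i _ => by
    show ‖F (fun l => s • siteToE (i.2.1 l)) * ∏ l ∈ Finset.univ \ i.2.2, (-(m (i.1 l) : ℂ))‖ ≤ _
    rw [norm_mul, norm_prod]
    refine mul_le_mul_of_nonneg_left ?_ (norm_nonneg _)
    calc ∏ l ∈ Finset.univ \ i.2.2, ‖(-(m (i.1 l) : ℂ))‖ ≤ ∏ _l ∈ Finset.univ \ i.2.2, max 1 Cp :=
          Finset.prod_le_prod (fun _ _ => norm_nonneg _) fun l _ => by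
            rw [norm_neg, Complex.norm_real, Real.norm_eq_abs]
            exact hmb (i.1 l)
      _ = max 1 Cp ^ (Finset.univ \ i.2.2).card := Finset.prod_const _
      _ ≤ max 1 Cp ^ n := pow_le_pow_right₀ hB1 (by simpa using Finset.card_le_univ (Finset.univ \ i.2.2))
  -- H3 on each pair of uncentred species
  have hKij : ∀ i ∈ I n R, ∀ j ∈ I n R,
      ‖osCorr μ GaugeConfig.timeReflect (⇑(torusTimeShift (2 * L + 1) M)) (Xo i) (Xo j)‖ ≤
        K n i j * Real.exp (-(c₁ * a β * M)) := fun i hi j _ => by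
    have hq : ∀ l, (i.1 l).1 < (i.1 l).2 := (mem_planeStrings_iff'' i.1).1 (Finset.mem_product.1 hi).1
    have h : osCorr μ GaugeConfig.timeReflect (⇑(torusTimeShift (2 * L + 1) M)) (Xo i) (Xo j) =
        (latticeConnectedCorr r.ρ β (2 * L + 1) (spec n i.2.2 i.1 fun l => thetaSite (i.1 l) (i.2.1 l)).F
          (spec n j.2.2 j.1 j.2.1).F M : ℂ) :=
      osCorr_prodPlane_eq r β L M (fun l _ => hq l) i.2.1 j.1 j.2.2 j.2.1
        (hspec n i.2.2 i.1 fun l => thetaSite (i.1 l) (i.2.1 l)) (hspec n j.2.2 j.1 j.2.1)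
    rw [h, Complex.norm_real, Real.norm_eq_abs]
    exact (hC _ _ β hβmem hβ L M hL hML).trans (mul_le_mul_of_nonneg_right (le_abs_self _) (Real.exp_nonneg _))
  have hsum : ∑ i ∈ I n R, ‖F (fun l => s • siteToE (i.2.1 l))‖ =
      2 ^ n * ∑ _q ∈ Fintype.piFinset (fun _ : Fin n => Finset.univ.filter fun pl : Fin 4 × Fin 4 => pl.1 < pl.2),
        ∑ y ∈ Fintype.piFinset (fun _ : Fin n => box 4 R), ‖F (fun l => s • siteToE (y l))‖ :=
    sum_idx_eq _ _ fun y => ‖F (fun l => s • siteToE (y l))‖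
  -- assemble
  rw [hX]
  refine (norm_osCorr_sum_le hΘm hτm (I n R) c hXm hXb (by positivity) hw (fun i _ => norm_nonneg _)
    (Real.exp_nonneg _) (fun i _ j _ => hKn n i j) hKij).trans ?_
  rw [hsum]
  calc (2 ^ n * ∑ _q ∈ Fintype.piFinset (fun _ : Fin n => Finset.univ.filter fun pl : Fin 4 × Fin 4 => pl.1 < pl.2),
          ∑ y ∈ Fintype.piFinset (fun _ : Fin n => box 4 R), ‖F (fun l => s • siteToE (y l))‖) ^ 2 *
        (max 1 Cp ^ n * max 1 Cp ^ n * ∑ i ∈ I n R, ∑ j ∈ I n R, K n i j) * Real.exp (-(c₁ * a β * M))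
      = (∑ _q ∈ Fintype.piFinset (fun _ : Fin n => Finset.univ.filter fun pl : Fin 4 × Fin 4 => pl.1 < pl.2),
          ∑ y ∈ Fintype.piFinset (fun _ : Fin n => box 4 R), ‖F (fun l => s • siteToE (y l))‖) ^ 2 *
        (2 ^ n * 2 ^ n * max 1 Cp ^ n * max 1 Cp ^ n * ∑ i ∈ I n R, ∑ j ∈ I n R, K n i j) *
          Real.exp (-(c₁ * a β * M)) := by ring
    _ ≤ _ := by
      gcongr
      exact le_add_of_nonneg_left zero_le_one

end Summit.QuantumFields.YangMills.Theorems.OSLegsAtWeakCouplingC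

/-! ## §2 The rope along soft bundles whose couplings lie in the set -/

namespace Summit.QuantumFields.YangMills.Cruxes.OSLegsFromFemtoAndGap.DlrCollarTransfer

local notation "E4" => EuclideanSpace ℝ (Fin 4)

open Summit.QuantumFields.YangMills.Theorems.OSLegsAtWeakCouplingC
open Summit.QuantumFields.YangMills.Cruxes.LatticeGapOnTrajectory.OrbitKantorovichFiniteSize.Transfer
  (Hankel.norm_osCorr_timeShift_le_of_decay Hankel.osVar_timeReflect_nonneg Hankel.torusTimeShift_one_iterate)

/-- **The lattice reflection-positivity rope with H3 on a set of couplings** (`stub_rope` verbatim; the soft bundle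
is additionally required to have all its couplings in `Bset`, which is where the anchor is read). -/
theorem stub_rope_onCouplings {G : Type} [Group G] [TopologicalSpace G] [IsTopologicalGroup G] [CompactSpace G]
    [MeasurableSpace G] [BorelSpace G] (r : LatticeRep G) (a : ℝ → ℝ)
    (hapos : ∀ β, 0 < a β) (ha0 : Tendsto a atTop (𝓝 0)) (Bset : Set ℝ)
    (hgap : ∃ (c₁ β₂ : ℝ) (S₁ : ℝ → ℕ), 0 < c₁ ∧ ∀ A B : YMSpecies G, ∃ C : ℝ, ∀ β ∈ Bset, β₂ ≤ β →
      ∀ S n : ℕ, S₁ β ≤ S → n ≤ S →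
        |latticeConnectedCorr r.ρ β (2 * S + 1) A.F B.F n| ≤ C * Real.exp (-(c₁ * a β * n))) :
    ∃ (b₀ : ℝ) (g : ℝ → ℕ → ℕ) (Δ : ℝ), 0 < Δ ∧
      ∀ (sch : SpeciesScheme (YMSpecies G)) (S₁ : SchwingerFamily E4)
        (Tq : (n : ℕ) → (Fin n → Fin 4 × Fin 4) → (𝓢((Fin n → E4), ℂ) →L[ℂ] ℂ)) (K : ℝ),
        SoftBundle G r a sch S₁ Tq K b₀ g → (∀ k, sch.β k ∈ Bset) → RPPos S₁ ∧ Decay S₁ Δ := by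
  obtain ⟨c₁, β₂, S₁g, D, hc₁, hDm, hD1, hanchor⟩ := exists_anchor_on r Bset hgap
  obtain ⟨growth, hgrowth⟩ := exists_ropeGrowth hapos D hDm hD1
  refine ⟨β₂, fun β k => max (S₁g β) (growth β k), c₁, hc₁, fun sch S₁ Tq K hB hmem => ?_⟩
  have hRP : RPPos S₁ := rpPos_of_softBundle' hapos ha0 hB
  refine ⟨hRP, fun n F hFo hFp hFc _ t ht => ?_⟩
  obtain ⟨⟨h1, -, -, -, -, -, -, h8, h9, -, -, -, -, -, -, -, h17, -, -, -, -⟩, h22⟩ := id hB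
  -- arity `0`: both connected forms vanish
  rcases Nat.eq_zero_or_pos n with hn | hn
  · subst hn
    rw [RopeGrowth.conn_arity_zero S₁ h9, RopeGrowth.conn_arity_zero S₁ h9, Complex.zero_re, zero_mul]
  -- `t = 0`: trivial
  rcases ht.eq_or_lt with rfl | ht'
  · rw [RopeGrowth.translateMulti_single_zero, mul_zero, neg_zero, Real.exp_zero, mul_one]
  -- `t > 0`, `n ≥ 1`: the rope
  -- the support radius and the time support
  obtain ⟨ρ, hρ0, hρ⟩ := hFc.isCompact.isBounded.subset_closedBall_lt 0 0
  have hFT : ∀ u : Fin n → EuclideanSpace ℝ (Fin 4), (∃ l, u l 0 ≤ 0 ∨ ρ < u l 0) → F u = 0 := by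
    intro u hu
    by_contra hne
    have hmem := subset_tsupport _ hne
    obtain ⟨l, hl | hl⟩ := hu
    · exact absurd (hFp hmem l) (not_lt.2 hl)
    · have h1 : ‖u‖ ≤ ρ := mem_closedBall_zero_iff.1 (hρ hmem)
      have h2 : u l 0 ≤ ‖u‖ :=
        ((le_abs_self _).trans (by simpa using PiLp.norm_apply_le (u l) 0)).trans (norm_le_pi_norm u l)
      linarith
  -- the dyadic steps
  obtain ⟨m, hm⟩ : ∃ m : ℕ → ℕ, ∀ k, m k = ⌊t / sch.a k⌋₊ := ⟨_, fun _ => rfl⟩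
  obtain ⟨w, hw⟩ : ∃ w : ℕ → ℕ, ∀ k, w k = ⌈ρ / sch.a k⌉₊ + 1 := ⟨_, fun _ => rfl⟩
  obtain ⟨J, hJ⟩ : ∃ J : ℕ → ℕ, ∀ k, J k = Nat.log 2 ((sch.L k - 2 * w k) / m k) := ⟨_, fun _ => rfl⟩
  obtain ⟨hev, hmt, hNtop, hloss⟩ := hgrowth sch.β sch.a sch.L h1 (fun k => (le_max_right _ _).trans (h22 k).2)
    sch.tendsto_a n ρ hρ0.le t ht' m w J hm hw hJ
  have hb : ∀ᶠ k in atTop, 1 ≤ sch.L k ∧ 2 ^ J k * m k + w k ≤ sch.L k ∧ w k + 2 ^ J k * m k ≤ sch.L k ∧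
      w k ≤ 2 * sch.L k ∧ ⌈ρ / sch.a k⌉₊ + 2 + m k ≤ sch.L k + 1 ∧ ⌈ρ / sch.a k⌉₊ + 2 + 0 ≤ sch.L k + 1 := by
    filter_upwards [hev] with k hk
    obtain ⟨hk1, hk2, hk3⟩ := hk
    have := hw k
    omega
  -- lattice support of `F` at scale `a_k`
  have hsupp : ∀ k (y : Fin n → Site 4), F (fun l => sch.a k • siteToE (y l)) ≠ 0 → ∀ l,
      y l ∈ box 4 (w k) ∧ 1 ≤ y l 0 ∧ y l 0 + 1 ≤ (w k : ℤ) := fun k y hy l => by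
    rw [hw k]; exact RopeGrowth.lattice_support hFp hρ (sch.a_pos k) hy l
  have hvan : ∀ k (y : Fin n → Site 4), (∃ l, y l 0 ≤ 0) → F (fun l => sch.a k • siteToE (y l)) = 0 :=
    fun k y ⟨l, hl⟩ => apply_eq_zero_of_time (sch.a_pos k) F hFT y ⟨l, Or.inl hl⟩
  -- the lattice objects
  set mk : ℕ → Fin 4 × Fin 4 → ℝ := fun k pl =>
    wilsonTorusMean r.ρ (sch.β k) (sch.L k) (fun U => plaquetteObs r.ρ 0 pl.1 pl.2 U) with hmk
  set S : ℕ → ℝ := fun k => ∑ _q ∈ Fintype.piFinset (fun _ : Fin n => Finset.univ.filter fun pl : Fin 4 × Fin 4 => pl.1 < pl.2),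
    ∑ y ∈ Fintype.piFinset (fun _ : Fin n => box 4 (w k)), ‖F (fun l => sch.a k • siteToE (y l))‖ with hS
  set C : ℕ → ℝ := fun k => (1 + S k) ^ 2 * D n (w k) with hC
  set V : ℕ → ℝ := fun k => osVar (wilsonMeasure (d := 4) (L := 2 * sch.L k + 1) r.ρ (sch.β k))
    GaugeConfig.timeReflect (fieldObs r (sch.L k) (sch.a k) F (mk k)) with hV
  have hS0 : ∀ k, 0 ≤ S k := fun k => Finset.sum_nonneg fun _ _ => Finset.sum_nonneg fun _ _ => norm_nonneg _
  have hC1 : ∀ k, 1 ≤ C k := fun k =>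
    one_le_mul_of_one_le_of_one_le (one_le_pow₀ (by linarith [hS0 k])) (hD1 n _)
  -- (a) the limits of the shifted autocorrelation and of the OS variance
  have hx := tendsto_osCorr_softBundle hapos ha0 hB hn F hFp hFo hFT m hmt (hb.mono fun k hk => hk.2.2.2.2.1)
  have hV0 : ∀ k, 0 ≤ V k := fun k =>
    Hankel.osVar_timeReflect_nonneg r.ρ r.continuous (h17 k).1 (le_trans (by norm_num) (h17 k).2.2.1)
      (measurable_fieldObs r _ _ F _) (exists_norm_fieldObs_le r _ _ F _)
      (dependsOn_fieldObs r (le_trans (by norm_num) (h17 k).2.2.1) _ F (hvan k) _)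
  have hVt : Tendsto V atTop (𝓝 (S₁ (n + n) ((osAdjoint F).appendTensor
      (translateMulti (EuclideanSpace.single 0 (0 : ℝ)) F)) - conj (S₁ n F) * S₁ n F).re) := by
    have h := tendsto_osCorr_softBundle hapos ha0 hB hn F hFp hFo hFT (fun _ => 0) (t := 0)
      (by simp) (hb.mono fun k hk => hk.2.2.2.2.2)
    refine ((Complex.continuous_re.tendsto _).comp h).congr fun k => ?_
    simp only [Function.comp_apply, hV, osVar, rope_coe_torusTimeShift_zero]
    rfl
  -- (b) the Hankel bound, eventually
  have hle : ∀ᶠ k in atTop, ‖osCorr (wilsonMeasure (d := 4) (L := 2 * sch.L k + 1) r.ρ (sch.β k))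
      GaugeConfig.timeReflect (⇑(torusTimeShift (2 * sch.L k + 1) (m k)))
      (fieldObs r (sch.L k) (sch.a k) F (mk k)) (fieldObs r (sch.L k) (sch.a k) F (mk k))‖ ≤
      (V k ^ (2 ^ J k - 1) * C k) ^ (((2 ^ J k : ℕ) : ℝ)⁻¹) * Real.exp (-(c₁ * (sch.a k * m k))) := by
    filter_upwards [hb] with k hk
    obtain ⟨hL1, hJm, hRM, hw2, -, -⟩ := hk
    -- the far bound of the anchor at separation `2^J m`
    have hfar := hanchor (sch.β k) (hmem k) (h22 k).1 (sch.L k) ((le_max_left _ _).trans (h22 k).2) (2 ^ J k * m k) (w k)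
      hRM (sch.a k) F (fun y hy l => ⟨(hsupp k y hy l).1, (hsupp k y hy l).2.1⟩)
    have hfar' : ‖osCorr (wilsonMeasure (d := 4) (L := 2 * sch.L k + 1) r.ρ (sch.β k)) GaugeConfig.timeReflect
        (⇑(torusTimeShift (2 * sch.L k + 1) (2 ^ J k * m k)))
        (fieldObs r (sch.L k) (sch.a k) F (mk k)) (fieldObs r (sch.L k) (sch.a k) F (mk k))‖ ≤
        C k * Real.exp (-(c₁ * sch.a k * (2 ^ J k * m k))) := by
      refine hfar.trans ?_
      have he : c₁ * a (sch.β k) * ((2 ^ J k * m k : ℕ) : ℝ) = c₁ * sch.a k * (2 ^ J k * m k) := by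
        rw [h1 k]; push_cast; ring
      rw [he]
      exact rope_sq_mul_mul_le (hS0 k) (zero_le_one.trans (hD1 n _)) (Real.exp_nonneg _)
    have h := Hankel.norm_osCorr_timeShift_le_of_decay r.ρ r.continuous (h17 k).1 hL1
      (measurable_fieldObs r _ _ F _) (exists_norm_fieldObs_le r _ _ F _)
      (RopeRP.dependsOn_fieldObs_slab r hw2 _ F (fun y hy l => (hsupp k y hy l).2) _) hJm hfar'
    refine h.trans_eq ?_
    congr 2
    · push_cast; rfl
    · ring
  -- (c) pass to the limit
  have hexp : Tendsto (fun k => Real.exp (-(c₁ * (sch.a k * m k)))) atTop (𝓝 (Real.exp (-(c₁ * t)))) :=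
    (Real.continuous_exp.tendsto _).comp ((hmt.const_mul c₁).neg)
  have key := le_of_hankel_tendsto hle ((continuous_norm.tendsto _).comp hx) hV0 hVt hNtop
    (fun k => zero_lt_one.trans_le (hC1 k))
    (hloss _ (apply_nonneg _ _) S hS0 fun k => RopeGrowth.sum_norm_apply_le F (sch.a k) (w k)) hexp
  -- (d) identification through hermiticity
  rw [RopeGrowth.translateMulti_single_zero] at key
  have hct := RopeGrowth.conn_translate_of_rpPos S₁ h9 h8 hRP hFp hFo (EuclideanSpace.single 0 t)
  have hc0 := RopeGrowth.conn_translate_of_rpPos S₁ h9 h8 hRP hFp hFo (EuclideanSpace.single 0 (0 : ℝ))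
  rw [RopeGrowth.translateMulti_single_zero] at hc0
  rw [← hct, ← hc0] at key
  exact (Complex.re_le_norm _).trans key

end Summit.QuantumFields.YangMills.Cruxes.OSLegsFromFemtoAndGap.DlrCollarTransfer

end
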